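import Summits.FinalStateConjecture.FinalStateConjecture.Theorems.ClusterCompletenessRecurrentlyFlatDispersesRestart
import Summits.FinalStateConjecture.FinalStateConjecture.Theorems.ClusterCompletenessRecurrentlyFlatDispersesFutureSetExit
import Literature.Geometry.Lorentzian.CauchyDevelopmentGlobalHyperbolicityProofs
import Literature.Geometry.Manifold.InverseFunctionTheorem

/-!
# Crux `KillingSpinorEndgame` (stmt-FinalStateConjecture-17645), route `KerrnessPropagates`,
# line `registered` — registered stub `stub_flatExhaustion` (DISPERSAL EXHAUSTION)

Let `Φ : U → 𝒟` be an ANCHORED FLAT LATE CHART of a vacuum Cauchy development after the base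
time `τb`: smooth, an open embedding, `U ⊇ {x⁰ > τb}`, `range Φ ⊆ J⁺(ιX)`, pointwise `C⁰` anchor
`‖Φ^* g − η‖ ≤ 1/4` and `Φ_*∂₀` future-directed on `{x⁰ > τb}`. Then for `τb < τ₁ ≤ τ` every point
of the self-determined exterior `J⁺(ιX) ∩ I⁻(Φ{x⁰ > τ₁})` outside the late image `Φ{x⁰ > τ}` lies
in `J⁻(Φ{x⁰ = τ})` (`stub_flatExhaustion : Sig.stub_flatExhaustion`, explicitly `flatExhaustion`).

Proof (`FlatExhaustion.mem_causalPast_slab_of_chart`). A point `p` of the exterior has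
`p ≪ c = Φ z`, `z⁰ > τ₁ > τb`. If `z⁰ ≤ τ`, ride the chart vertical from `c` up to the slab
(`Restart.mem_chronologicalFuture_of_eq_add_smul`) and use `J⁻ ∘ J⁻ = J⁻`. If `z⁰ > τ`, `c` lies in
the OPEN late image `W_τ = Φ{x⁰ > τ}` and `p` does not; at the FIRST ENTRY parameter `σ` of the
timelike curve `γ` from `p` to `c` into `W_τ`: `γ σ ∉ W_τ`, `p ≤ γ σ`, and `γ(σ, b] ⊆ W_τ` because
`W_τ` is a FUTURE SET (`FutureSet.forall_mem_range` for `Φ|{x⁰ > τ}`, an injective local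
diffeomorphism with the cone estimate by the anchor). The coordinate lift `Φ⁻¹ ∘ γ` on `(σ, b]`
(`FutureSet.lift_cone`) has increasing chart time `> τ` and displacement `≤ 2 Δx⁰`
(`FutureSet.norm_sub_le_of_hasDerivAt`), so as `s ↓ σ` it is Cauchy and converges to `y* ∈ U`,
`y*⁰ ≥ τ`, with `Φ y* = γ σ` (continuity, Hausdorff); since `γ σ ∉ W_τ`, `y*⁰ = τ` and
`p ≤ γ σ ∈ Φ{x⁰ = τ}`. No frontier-at-infinity analysis is needed (chart time DEcreases to `σ`).
Mathlib + Literature causal theory + the kernel-checked bricks `FutureSet.*`, `Restart.*` (crux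
stmt-14665); no named facts. References: B. O'Neill, *Semi-Riemannian geometry*, Academic Press
1983, Ch. 14, pp. 402–403; M. Dafermos, J. Luk, arXiv:1710.01722 (2017), Conjecture 1 (dispersal);
M. Dafermos, G. Holzegel, I. Rodnianski, M. Taylor, arXiv:2104.08222, §1 (late flat charts).
-/


noncomputable section

-- `FinalStateConjecture.FinalStateConjecture` repeats summit = sub-problem (D-0017); deliberate.
set_option linter.dupNamespace false

open Literature.Geometry.Lorentzian
open scoped Manifold ContDiff Topology ENNReal
open Filter Set TopologicalSpace

namespace Summit.FinalStateConjecture.FinalStateConjecture.Theorems.KerrnessPropagates.KillingSpinorEndgame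

open Summit.FinalStateConjecture.FinalStateConjecture.Theorems.RecurrentlyFlatDisperses

namespace FlatExhaustion

/-- `2 ≤ ∞` in `ℕ∞ω` (regularity side condition of the causality theorems). [folklore] -/
private lemma two_le_infty : (2 : WithTop ℕ∞) ≤ ((⊤ : ℕ∞) : WithTop ℕ∞) :=
  WithTop.coe_le_coe.mpr le_top

/-- `J⁻` is transitive over sets: `x ≤ y` and `y ∈ J⁻(S)` give `x ∈ J⁻(S)`
(`causalFuture_causalFuture_eq` for the reversed time orientation). O'Neill 1983, Ch. 14, p. 402.
[cite: ONeill1983, Ch. 14 p. 402] -/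
private theorem causalPast_trans {𝓢 : Spacetime 4} {S : Set 𝓢.carrier} {x y : 𝓢.carrier}
    (hxy : x ∈ 𝓢.metric.causalPast 𝓢.timeOrientation {y})
    (hyS : y ∈ 𝓢.metric.causalPast 𝓢.timeOrientation S) :
    x ∈ 𝓢.metric.causalPast 𝓢.timeOrientation S := by
  have h : x ∈ 𝓢.metric.causalFuture 𝓢.timeOrientation.reverse
      (𝓢.metric.causalFuture 𝓢.timeOrientation.reverse S) :=
    LorentzianMetric.causalFuture_mono (Set.singleton_subset_iff.mpr hyS) hxy
  rw [LorentzianMetric.causalFuture_causalFuture_eq two_le_infty] at h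
  exact h

/-- **The coordinate lift converges at the first-entry parameter.** For `Φ : V → 𝓢`
(`V = {x⁰ > τ}`) an injective smooth local diffeomorphism with the cone estimate and a future
timelike curve `γ` on `(σ, b]` inside `Φ(V)`, the lift `c̃ = Φ⁻¹ ∘ γ` has increasing chart time
`> τ`, `‖c̃ s₂ − c̃ s₁‖ ≤ 2 (c̃⁰ s₂ − c̃⁰ s₁)` (`FutureSet.lift_cone`, `norm_sub_le_of_hasDerivAt`),
so it is Cauchy as `s ↓ σ` and converges in `E4` to a point `y` with `y⁰ ≥ τ`. O'Neill 1983,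
Ch. 14, p. 402; Ch. 3, pp. 90–91 (the lift). [cite: ONeill1983, Ch. 14 p. 402] -/
private theorem exists_tendsto_lift {𝓢 : Spacetime 4} {V : Opens E4} [Nonempty V]
    {Φ : V → 𝓢.carrier} {τ : ℝ} (hΦs : ContMDiff 𝓘(ℝ, E4) (𝓡 4) ∞ Φ)
    (hinj : Function.Injective Φ) (hloc : IsLocalDiffeomorph 𝓘(ℝ, E4) (𝓡 4) ∞ Φ)
    (hcone : ∀ (x : V) (w : E4), 𝓢.metric.IsTimelike (mfderiv 𝓘(ℝ, E4) (𝓡 4) Φ x w) →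
      𝓢.timeOrientation.IsFutureDirected (mfderiv 𝓘(ℝ, E4) (𝓡 4) Φ x w) →
      0 < w 0 ∧ ‖w‖ < 2 * w 0)
    (hVmem : ∀ p : E4, p ∈ V ↔ τ < p 0)
    {γ : ℝ → 𝓢.carrier} {σ b : ℝ} (hσb : σ < b)
    (hγ : 𝓢.metric.IsFutureTimelikeCurveOn 𝓢.timeOrientation γ (Ioc σ b))
    (hW : ∀ t ∈ Ioc σ b, γ t ∈ range Φ) :
    ∃ y : E4, τ ≤ y 0 ∧
      Tendsto (fun t ↦ ((Function.invFun Φ (γ t) : V) : E4)) (𝓝[>] σ) (𝓝 y) := by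
  set c : ℝ → E4 := fun t ↦ ((Function.invFun Φ (γ t) : V) : E4) with hc
  -- derivative and cone estimate along the lift
  have hder : ∀ t ∈ Ioc σ b, HasDerivAt c (deriv c t) t ∧ 0 < deriv c t 0 ∧
      ‖deriv c t‖ < 2 * deriv c t 0 := fun t ht ↦ by
    obtain ⟨hd, h1, h2⟩ := FutureSet.lift_cone hΦs hinj hloc hcone (hγ t ht) (hW t ht)
    exact ⟨hd.hasDerivAt, h1, h2⟩
  have hmono : StrictMonoOn (fun t ↦ c t 0) (Ioc σ b) :=
    FutureSet.strictMonoOn_apply_zero (w := fun t ↦ deriv c t) (convex_Ioc σ b)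
      fun t ht ↦ ⟨(hder t ht).1, (hder t ht).2.1⟩
  have hdisp : ∀ s₁ s₂ : ℝ, σ < s₁ → s₁ ≤ s₂ → s₂ ≤ b →
      ‖c s₂ - c s₁‖ ≤ 2 * (c s₂ 0 - c s₁ 0) := fun s₁ s₂ h1 h12 h2 ↦
    FutureSet.norm_sub_le_of_hasDerivAt (w := fun t ↦ deriv c t) h12 fun t ht ↦
      ⟨(hder t ⟨lt_of_lt_of_le h1 ht.1, ht.2.trans h2⟩).1,
        (hder t ⟨lt_of_lt_of_le h1 ht.1, ht.2.trans h2⟩).2.2.le⟩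
  -- chart time is `> τ` along the lift
  have hcτ : ∀ t : ℝ, τ < c t 0 := fun t ↦ (hVmem _).1 (Function.invFun Φ (γ t)).2
  -- the lift is Cauchy at `σ⁺`
  set L : ℝ := sInf ((fun t ↦ c t 0) '' Ioc σ b) with hL
  have hne : ((fun t ↦ c t 0) '' Ioc σ b).Nonempty := ⟨c b 0, b, ⟨hσb, le_rfl⟩, rfl⟩
  have hbdd : BddBelow ((fun t ↦ c t 0) '' Ioc σ b) := by
    refine ⟨τ, ?_⟩
    rintro _ ⟨t, -, rfl⟩
    exact (hcτ t).le
  have hfL : ∀ t ∈ Ioc σ b, L ≤ c t 0 := fun t ht ↦ csInf_le hbdd ⟨t, ht, rfl⟩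
  have hcau : Cauchy (map c (𝓝[>] σ)) := by
    rw [Metric.cauchy_iff]
    refine ⟨inferInstance, fun ε hε ↦ ?_⟩
    obtain ⟨_, ⟨s₁, hs₁, rfl⟩, hLs₁⟩ :=
      exists_lt_of_csInf_lt hne (show L < L + ε / 4 by linarith)
    refine ⟨c '' Ioo σ s₁, image_mem_map (Ioo_mem_nhdsGT hs₁.1), ?_⟩
    rintro _ ⟨u, hu, rfl⟩ _ ⟨u', hu', rfl⟩
    have key : ∀ v v' : ℝ, v ∈ Ioo σ s₁ → v' ∈ Ioo σ s₁ → v ≤ v' → dist (c v) (c v') < ε := by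
      intro v v' hv hv' hvv'
      rw [dist_comm, dist_eq_norm]
      have h1 := hdisp v v' hv.1 hvv' (hv'.2.le.trans hs₁.2)
      have h2 := hfL v ⟨hv.1, hv.2.le.trans hs₁.2⟩
      have h3 : c v' 0 ≤ c s₁ 0 :=
        hmono.monotoneOn ⟨hv'.1, hv'.2.le.trans hs₁.2⟩ hs₁ hv'.2.le
      have h4 : c s₁ 0 < L + ε / 4 := hLs₁
      linarith
    rcases le_total u u' with h | h
    · exact key u u' hu hu' h
    · rw [dist_comm]; exact key u' u hu' hu h
  obtain ⟨y, hy'⟩ : ∃ y : E4, Tendsto c (𝓝[>] σ) (𝓝 y) := CompleteSpace.complete hcau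
  have hy0 : Tendsto (fun t ↦ c t 0) (𝓝[>] σ) (𝓝 (y 0)) :=
    ((PiLp.continuous_apply 2 (fun _ : Fin 4 ↦ ℝ) 0).tendsto y).comp hy'
  have hfa : ∀ᶠ t in 𝓝[>] σ, τ ≤ c t 0 := Eventually.of_forall fun t ↦ (hcτ t).le
  exact ⟨y, ge_of_tendsto hy0 hfa, hy'⟩

/-- **Dispersal exhaustion for an anchored chart (geometric form).** Let `Ψ₀ : U₀ → 𝓢` be a
smooth open embedding on an open `U₀ ⊇ {x⁰ > τb}` of `E4`, anchored (`‖Ψ₀^* g − η‖ ≤ 1/4`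
pointwise on `{x⁰ > τb}`) with `dΨ₀ ∂₀` future-directed there, whose range lies in `J⁺(S)` for a
set `S` with all `J⁻(q) ∩ J⁺(S)` compact, in a strongly causal spacetime. If `p ≪ Ψ₀ z` with
`z⁰ > τb` and `p ∉ Ψ₀{x⁰ > τ}`, `τ > τb`, then `p ∈ J⁻(Ψ₀{x⁰ = τ})`: ride the chart vertical if
`z⁰ ≤ τ` (`Restart.mem_chronologicalFuture_of_eq_add_smul`); otherwise the first-entry point of the
timelike curve from `p` into the open future set `Ψ₀{x⁰ > τ}` (`FutureSet.forall_mem_range`) is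
the `Ψ₀`-image of the limit of the coordinate lift (`exists_tendsto_lift`), which lies on the slab.
O'Neill 1983, Ch. 14, pp. 402–403. [cite: ONeill1983, Ch. 14 pp. 402–403] -/
theorem mem_causalPast_slab_of_chart {𝓢 : Spacetime 4}
    (hsc : 𝓢.metric.IsStronglyCausal 𝓢.timeOrientation) {S : Set 𝓢.carrier}
    (hK : ∀ q : 𝓢.carrier, IsCompact (𝓢.metric.causalPast 𝓢.timeOrientation {q} ∩
      𝓢.metric.causalFuture 𝓢.timeOrientation S))
    {U₀ : Opens E4} {Ψ₀ : U₀ → 𝓢.carrier} {τb : ℝ}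
    (hΨs : ContMDiff 𝓘(ℝ, E4) (𝓡 4) ∞ Ψ₀) (hemb : Topology.IsOpenEmbedding Ψ₀)
    (hU : {x : E4 | τb < x 0} ⊆ (U₀ : Set E4))
    (hWS : range Ψ₀ ⊆ 𝓢.metric.causalFuture 𝓢.timeOrientation S)
    (hdev : ∀ y : U₀, τb < y.1 0 → ‖𝓢.deviation (Minkowski.backgroundOn U₀) Ψ₀ y‖ ≤ 1 / 4)
    (hfut : ∀ y : U₀, τb < y.1 0 →
      𝓢.timeOrientation.IsFutureDirected (mfderiv 𝓘(ℝ, E4) (𝓡 4) Ψ₀ y (E4.basisVector 0)))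
    {τ : ℝ} (hτ : τb < τ) {p : 𝓢.carrier} {z : U₀} (hz : τb < z.1 0)
    (hpz : p ∈ 𝓢.metric.chronologicalPast 𝓢.timeOrientation {Ψ₀ z})
    (hpW : p ∉ Ψ₀ '' (Minkowski.backgroundOn U₀).lateRegion τ) :
    p ∈ 𝓢.metric.causalPast 𝓢.timeOrientation
      (Ψ₀ '' (Minkowski.backgroundOn U₀).timeSlab τ) := by
  set g := 𝓢.metric with hg
  set T := 𝓢.timeOrientation with hT
  set Sτ : Set 𝓢.carrier := Ψ₀ '' (Minkowski.backgroundOn U₀).timeSlab τ with hSτ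
  -- the vertical differential is uniformly timelike and future-directed on `{x⁰ > τb}`
  have hvert₀ : ∀ y : U₀, τb < y.1 0 →
      g.val (Ψ₀ y) (mfderiv 𝓘(ℝ, E4) (𝓡 4) Ψ₀ y (E4.basisVector 0))
          (mfderiv 𝓘(ℝ, E4) (𝓡 4) Ψ₀ y (E4.basisVector 0)) ≤ -(3 / 4) ∧
        T.IsFutureDirected (mfderiv 𝓘(ℝ, E4) (𝓡 4) Ψ₀ y (E4.basisVector 0)) :=
    fun y hy ↦ ⟨FutureSet.val_mfderiv_basisVector_zero_le Ψ₀ y (hdev y hy), hfut y hy⟩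
  -- `p ≤ Ψ₀ z`
  have hpJ : p ∈ g.causalPast T {Ψ₀ z} :=
    LorentzianMetric.chronologicalFuture_subset_causalFuture _ _ _ hpz
  have e00 : (E4.basisVector 0 : E4) 0 = 1 := by simp [E4.basisVector]
  by_cases hzτ : z.1 0 ≤ τ
  · -- CASE `z⁰ ≤ τ`: ride the chart vertical from `Ψ₀ z` up to the slab
    have hcS : Ψ₀ z ∈ g.causalPast T Sτ := by
      rcases eq_or_lt_of_le hzτ with h | h
      · exact LorentzianMetric.subset_causalPast g T Sτ ⟨z, h, rfl⟩
      · set s : ℝ := τ - z.1 0 with hs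
        have hs0 : 0 < s := sub_pos.mpr h
        have hy0 : (z.1 + s • (E4.basisVector 0 : E4)) 0 = τ := by
          simp only [PiLp.add_apply, PiLp.smul_apply, smul_eq_mul, e00, mul_one, hs]
          ring
        have hyU : z.1 + s • (E4.basisVector 0 : E4) ∈ (U₀ : Set E4) :=
          hU (show τb < (z.1 + s • (E4.basisVector 0 : E4)) 0 by rw [hy0]; exact hτ)
        set y : U₀ := ⟨z.1 + s • (E4.basisVector 0 : E4), hyU⟩ with hy
        have hyS : Ψ₀ y ∈ Sτ := ⟨y, hy0, rfl⟩
        have hzy : Ψ₀ y ∈ g.chronologicalFuture T {Ψ₀ z} :=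
          Restart.mem_chronologicalFuture_of_eq_add_smul hΨs hU hvert₀ z y hz hs0 rfl
        have hzy' : Ψ₀ z ∈ g.causalPast T {Ψ₀ y} :=
          LorentzianMetric.chronologicalFuture_subset_causalFuture g T.reverse {Ψ₀ y}
            (LorentzianMetric.mem_chronologicalPast_of_mem_chronologicalFuture hzy)
        exact causalPast_trans hzy' (LorentzianMetric.subset_causalPast g T Sτ hyS)
    exact causalPast_trans hpJ hcS
  -- CASE `z⁰ > τ`: first entry of the timelike curve into the open future set `Ψ₀{x⁰ > τ}`
  push Not at hzτ
  -- the late half-space `V` and the chart `Φ = Ψ₀|V`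
  obtain ⟨V, hVmem⟩ : ∃ V : Opens E4, ∀ q : E4, q ∈ V ↔ τ < q 0 :=
    ⟨⟨{x : E4 | τ < x 0}, isOpen_lt continuous_const (PiLp.continuous_apply 2 _ 0)⟩,
      fun _ ↦ Iff.rfl⟩
  have hVU : V ≤ U₀ := fun q hq ↦ hU (hτ.trans ((hVmem q).1 hq))
  haveI : Nonempty V :=
    ⟨⟨(τ + 1) • (E4.basisVector 0 : E4), (hVmem _).2 (by simp [E4.basisVector])⟩⟩
  have hlate : ∀ x : V, τ < (Opens.inclusion hVU x).1 0 := fun x ↦ (hVmem x.1).1 x.2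
  have hlateb : ∀ x : V, τb < (Opens.inclusion hVU x).1 0 := fun x ↦ hτ.trans (hlate x)
  set Φ : V → 𝓢.carrier := Ψ₀ ∘ Opens.inclusion hVU with hΦdef
  have hΦs : ContMDiff 𝓘(ℝ, E4) (𝓡 4) ∞ Φ := hΨs.comp (contMDiff_inclusion hVU)
  have hdΦ : ∀ x : V, mfderiv 𝓘(ℝ, E4) (𝓡 4) Φ x =
      mfderiv 𝓘(ℝ, E4) (𝓡 4) Ψ₀ (Opens.inclusion hVU x) := fun x ↦
    FutureSet.mfderiv_comp_inclusion hVU x (hΨs.mdifferentiableAt (by simp))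
  have hrange : range Φ = Ψ₀ '' (Minkowski.backgroundOn U₀).lateRegion τ :=
    FutureSet.range_comp_inclusion hVU Ψ₀ hVmem
  have hWopen : IsOpen (range Φ) := by
    rw [hrange]
    refine hemb.isOpenMap _ ?_
    exact isOpen_lt continuous_const ((PiLp.continuous_apply 2 _ 0).comp continuous_subtype_val)
  have hinj : Function.Injective Φ := by
    intro x₁ x₂ h
    have h' : Opens.inclusion hVU x₁ = Opens.inclusion hVU x₂ := hemb.injective h
    exact Subtype.ext (congrArg (fun y : U₀ ↦ (y : E4)) h')
  have hloc : IsLocalDiffeomorph 𝓘(ℝ, E4) (𝓡 4) ∞ Φ := fun x ↦ by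
    have hinjd : Function.Injective (mfderiv 𝓘(ℝ, E4) (𝓡 4) Φ x) := by
      rw [hdΦ x]
      exact FutureSet.mfderiv_injective_of_deviation Ψ₀ _ (hdev _ (hlateb x))
    set A : E4 →L[ℝ] E4 := mfderiv 𝓘(ℝ, E4) (𝓡 4) Φ x with hA
    have hinjA : Function.Injective (A : E4 →ₗ[ℝ] E4) := hinjd
    have hbij : Function.Bijective (A : E4 →ₗ[ℝ] E4) :=
      ⟨hinjA, LinearMap.injective_iff_surjective.1 hinjA⟩
    set e : E4 ≃L[ℝ] E4 :=
      (LinearEquiv.ofBijective (A : E4 →ₗ[ℝ] E4) hbij).toContinuousLinearEquiv with he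
    exact Literature.Geometry.Manifold.isLocalDiffeomorphAt_of_mfderiv (by simp) isOpen_univ
      (mem_univ x) hΦs.contMDiffOn e (by ext v; rfl)
  have hcone : ∀ (x : V) (w : E4), g.IsTimelike (mfderiv 𝓘(ℝ, E4) (𝓡 4) Φ x w) →
      T.IsFutureDirected (mfderiv 𝓘(ℝ, E4) (𝓡 4) Φ x w) → 0 < w 0 ∧ ‖w‖ < 2 * w 0 := by
    intro x w ht hf
    rw [hdΦ x] at ht hf
    exact FutureSet.cone_of_deviation Ψ₀ (Opens.inclusion hVU x) (hdev _ (hlateb x))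
      (hfut _ (hlateb x)) w ht hf
  have hvert : ∀ x : V, g.val (Φ x) (mfderiv 𝓘(ℝ, E4) (𝓡 4) Φ x (E4.basisVector 0))
        (mfderiv 𝓘(ℝ, E4) (𝓡 4) Φ x (E4.basisVector 0)) ≤ -(3 / 4) ∧
      T.IsFutureDirected (mfderiv 𝓘(ℝ, E4) (𝓡 4) Φ x (E4.basisVector 0)) := by
    intro x
    rw [hdΦ x]
    exact hvert₀ _ (hlateb x)
  have hWS' : range Φ ⊆ g.causalFuture T S := fun q ⟨x, hx⟩ ↦ hWS ⟨_, hx⟩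
  -- the timelike curve from `p` to `Ψ₀ z ∈ Φ(V)`
  obtain ⟨p', hp', γ, a, b, hab, hγ, hγa, hγb⟩ :=
    LorentzianMetric.mem_chronologicalFuture_of_mem_chronologicalPast hpz
  rw [Set.mem_singleton_iff] at hp'
  have hγa' : γ a = p := hγa.trans hp'
  have hγc : ∀ s ∈ Icc a b, ContinuousAt γ s := fun s hs ↦ (hγ s hs).1.continuousAt
  have hzV : (z : E4) ∈ V := (hVmem _).2 hzτ
  have hγbW : γ b ∈ range Φ := ⟨⟨(z : E4), hzV⟩, (congrArg Ψ₀ (Subtype.ext rfl)).trans hγb.symm⟩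
  have hpW' : p ∉ range Φ := hrange ▸ hpW
  -- first entry: infimum of the parameters mapped into `Φ(V)`
  set A : Set ℝ := {s | s ∈ Icc a b ∧ γ s ∈ range Φ} with hAdef
  have hbA : b ∈ A := ⟨right_mem_Icc.mpr hab.le, hγbW⟩
  have hAne : A.Nonempty := ⟨b, hbA⟩
  have hAbdd : BddBelow A := ⟨a, fun s hs ↦ hs.1.1⟩
  set σ : ℝ := sInf A with hσdef
  have hσb : σ ≤ b := csInf_le hAbdd hbA
  have haσ : a ≤ σ := le_csInf hAne fun s hs ↦ hs.1.1
  have hσI : σ ∈ Icc a b := ⟨haσ, hσb⟩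
  -- `γ σ ∉ Φ(V)` (openness of `Φ(V)`; at `a` because `p ∉ Φ(V)`)
  have hnW : γ σ ∉ range Φ := by
    intro hσW
    have hne : a ≠ σ := by
      intro h
      rw [← h, hγa'] at hσW
      exact hpW' hσW
    have haσ' : a < σ := lt_of_le_of_ne haσ hne
    have hnhds : γ ⁻¹' range Φ ∈ 𝓝 σ := (hγc _ hσI).preimage_mem_nhds (hWopen.mem_nhds hσW)
    obtain ⟨ε, hε, hball⟩ := Metric.mem_nhds_iff.mp hnhds
    obtain ⟨s₁, hs₁a, hs₁ε, hs₁lt⟩ : ∃ s₁, a ≤ s₁ ∧ σ - ε / 2 ≤ s₁ ∧ s₁ < σ :=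
      ⟨max a (σ - ε / 2), le_max_left _ _, le_max_right _ _, max_lt haσ' (by linarith)⟩
    have hs₁A : s₁ ∈ A := by
      refine ⟨⟨hs₁a, hs₁lt.le.trans hσb⟩, ?_⟩
      apply hball
      rw [Metric.mem_ball, Real.dist_eq, abs_sub_lt_iff]
      constructor <;> linarith
    exact absurd (csInf_le hAbdd hs₁A) (not_le.mpr hs₁lt)
  have hσb' : σ < b := lt_of_le_of_ne hσb fun h ↦ hnW (h ▸ hγbW)
  -- after the first entry the curve stays in the future set `Φ(V)`
  have hbelow : ∀ t ∈ Ioc σ b, γ t ∈ range Φ := by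
    intro t ht
    obtain ⟨s', hs'A, hs't⟩ := exists_lt_of_csInf_lt hAne ht.1
    have hγ' : g.IsFutureTimelikeCurveOn T γ (Icc s' t) :=
      hγ.mono (Icc_subset_Icc hs'A.1.1 ht.2)
    exact FutureSet.forall_mem_range hΦs hinj hloc hcone hVmem hWopen hvert hsc hK hWS' hγ' hs'A.2 t
      ⟨hs't.le, le_rfl⟩
  -- the lift converges as `s ↓ σ`, to a point `y` of `U₀` with `y⁰ ≥ τ`
  obtain ⟨y, hyτ, hylim⟩ := exists_tendsto_lift hΦs hinj hloc hcone hVmem hσb'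
    (hγ.mono fun t ht ↦ ⟨haσ.trans ht.1.le, ht.2⟩) hbelow
  have hyU : y ∈ (U₀ : Set E4) := hU (lt_of_lt_of_le hτ hyτ)
  set w : U₀ := ⟨y, hyU⟩ with hw
  -- `Ψ₀ w = γ σ` (continuity of `Ψ₀` and of `γ`, Hausdorff)
  have hz' : Tendsto (fun t ↦ Opens.inclusion hVU (Function.invFun Φ (γ t))) (𝓝[>] σ) (𝓝 w) :=
    tendsto_subtype_rng.2 hylim
  have hΨz : Tendsto (fun t ↦ Ψ₀ (Opens.inclusion hVU (Function.invFun Φ (γ t)))) (𝓝[>] σ)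
      (𝓝 (Ψ₀ w)) :=
    (hΨs.continuous.tendsto _).comp hz'
  have heq : (fun t ↦ Ψ₀ (Opens.inclusion hVU (Function.invFun Φ (γ t)))) =ᶠ[𝓝[>] σ] γ := by
    filter_upwards [Ioc_mem_nhdsGT hσb'] with t ht
    exact Function.invFun_eq (hbelow t ht)
  have hlim : Tendsto γ (𝓝[>] σ) (𝓝 (Ψ₀ w)) := hΨz.congr' heq
  have hlim' : Tendsto γ (𝓝[>] σ) (𝓝 (γ σ)) :=
    (hγc σ hσI).tendsto.mono_left nhdsWithin_le_nhds
  have hγσ : γ σ = Ψ₀ w := tendsto_nhds_unique hlim' hlim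
  -- the limit point is on the slab: `y⁰ = τ`
  have hy0 : y 0 = τ := by
    by_contra hne
    have hlt : τ < y 0 := lt_of_le_of_ne hyτ (Ne.symm hne)
    refine hnW ?_
    rw [hrange, hγσ]
    exact ⟨w, hlt, rfl⟩
  have hσS : γ σ ∈ Sτ := by
    rw [hγσ]
    exact ⟨w, hy0, rfl⟩
  -- `p ≤ γ σ ∈ S_τ`
  have hpσ : p ∈ g.causalPast T {γ σ} := by
    rcases eq_or_lt_of_le haσ with h | h
    · rw [← h, hγa']
      exact LorentzianMetric.subset_causalPast _ _ _ (Set.mem_singleton p)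
    · exact LorentzianMetric.mem_causalPast_singleton_iff.mpr (Or.inr ⟨p, Set.mem_singleton p,
        γ, a, σ, h, (hγ.mono (Icc_subset_Icc le_rfl hσb)).isFutureCausalCurveOn, hγa', rfl⟩)
  exact causalPast_trans hpσ (LorentzianMetric.subset_causalPast g T Sτ hσS)

end FlatExhaustion

/-! ### The registered signature and the stub -/

/-- **Signature of the registered stub `stub_flatExhaustion`** — verbatim the `Prop`
`Sig.stub_flatExhaustion` of the skeleton `Cruxes/KillingSpinorEndgame/Lines/registered.lean`
(crux stmt-FinalStateConjecture-17645), restated because the skeleton carries `sorry`s and is not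
importable; an OBLIGATION of the line (proved below: `stub_flatExhaustion`), not a cited fact.
DISPERSAL EXHAUSTION of an anchored flat late chart, see the module docstring.
(ref: DafermosLuk2017, Conjecture 1; ONeill1983, Ch. 14 pp. 402–403) -/
def Sig.stub_flatExhaustion : Prop :=
  ∀ (X : Type) [TopologicalSpace X] [ChartedSpace E3 X] [IsManifold (𝓡 3) ∞ X]
    [T2Space X] [SecondCountableTopology X] [ConnectedSpace X] (D : InitialDataSet (𝓡 3) X)
    (𝒟 : VacuumCauchyDevelopment D) (τb : ℝ) (U : Opens E4) (Φ : U → 𝒟.carrier),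
    ContMDiff 𝓘(ℝ, E4) (𝓡 4) ∞ Φ → Topology.IsOpenEmbedding Φ →
    {x : E4 | τb < x 0} ⊆ (U : Set E4) →
    range Φ ⊆ 𝒟.metric.causalFuture 𝒟.timeOrientation (range 𝒟.embed) →
    (∀ y : U, τb < y.1 0 → ‖𝒟.toSpacetime.deviation (Minkowski.backgroundOn U) Φ y‖ ≤ 1 / 4) →
    (∀ y : U, τb < y.1 0 →
      𝒟.timeOrientation.IsFutureDirected (mfderiv 𝓘(ℝ, E4) (𝓡 4) Φ y (E4.basisVector 0))) →
    ∀ τ₁ τ : ℝ, τb < τ₁ → τ₁ ≤ τ →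
      Summit.FinalStateConjecture.exteriorOf 𝒟.toCauchyDevelopment
          (Φ '' (Minkowski.backgroundOn U).lateRegion τ₁) \
        Φ '' (Minkowski.backgroundOn U).lateRegion τ ⊆
      𝒟.metric.causalPast 𝒟.timeOrientation (Φ '' (Minkowski.backgroundOn U).timeSlab τ)

/-- **Dispersal exhaustion, explicit form.** For an anchored flat late chart `Φ : U → 𝒟` of a
vacuum Cauchy development after the base time `τb` (smooth open embedding, `U ⊇ {x⁰ > τb}`,
`range Φ ⊆ J⁺(ιX)`, `‖Φ^* g − η‖ ≤ 1/4` and `Φ_*∂₀` future-directed on `{x⁰ > τb}`) and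
`τb < τ₁ ≤ τ`: `J⁺(ιX) ∩ I⁻(Φ{x⁰ > τ₁}) \ Φ{x⁰ > τ} ⊆ J⁻(Φ{x⁰ = τ})` — a point of the left side
has `p ≪ Φ z`, `z⁰ > τ₁ > τb`, and `FlatExhaustion.mem_causalPast_slab_of_chart` applies in the
strongly causal development (`CauchyDevelopment.isStronglyCausal`) with `S = ιX`
(`CauchyDevelopment.isCompact_causalPast_inter_causalFuture_range`). O'Neill 1983, Ch. 14,
pp. 402–403; Dafermos–Luk 2017, Conjecture 1. [cite: ONeill1983, Ch. 14 pp. 402–403] -/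
theorem flatExhaustion {X : Type} [TopologicalSpace X] [ChartedSpace E3 X] [IsManifold (𝓡 3) ∞ X]
    [ConnectedSpace X] {D : InitialDataSet (𝓡 3) X} (𝒟 : VacuumCauchyDevelopment D) {τb : ℝ}
    {U : Opens E4} {Φ : U → 𝒟.carrier} (hsmooth : ContMDiff 𝓘(ℝ, E4) (𝓡 4) ∞ Φ)
    (hemb : Topology.IsOpenEmbedding Φ) (hU : {x : E4 | τb < x 0} ⊆ (U : Set E4))
    (hrange : range Φ ⊆ 𝒟.metric.causalFuture 𝒟.timeOrientation (range 𝒟.embed))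
    (hdev : ∀ y : U, τb < y.1 0 →
      ‖𝒟.toSpacetime.deviation (Minkowski.backgroundOn U) Φ y‖ ≤ 1 / 4)
    (hfut : ∀ y : U, τb < y.1 0 →
      𝒟.timeOrientation.IsFutureDirected (mfderiv 𝓘(ℝ, E4) (𝓡 4) Φ y (E4.basisVector 0)))
    {τ₁ τ : ℝ} (hτ₁ : τb < τ₁) (hτ₁τ : τ₁ ≤ τ) :
    Summit.FinalStateConjecture.exteriorOf 𝒟.toCauchyDevelopment
        (Φ '' (Minkowski.backgroundOn U).lateRegion τ₁) \
      Φ '' (Minkowski.backgroundOn U).lateRegion τ ⊆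
    𝒟.metric.causalPast 𝒟.timeOrientation (Φ '' (Minkowski.backgroundOn U).timeSlab τ) := by
  intro p hp
  obtain ⟨⟨-, hpI⟩, hpW⟩ := hp
  -- `p ≪ Φ z` for some `z` with `z⁰ > τ₁`
  have hpI' : p ∈ 𝒟.metric.chronologicalFuture 𝒟.timeOrientation.reverse
      (Φ '' (Minkowski.backgroundOn U).lateRegion τ₁) := hpI
  rw [LorentzianMetric.chronologicalFuture_eq_biUnion] at hpI'
  simp only [Set.mem_iUnion, exists_prop] at hpI'
  obtain ⟨c, ⟨z, hz, rfl⟩, hpc⟩ := hpI'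
  have hz' : τ₁ < z.1 0 := hz
  exact FlatExhaustion.mem_causalPast_slab_of_chart (𝓢 := 𝒟.toSpacetime)
    𝒟.toCauchyDevelopment.isStronglyCausal
    𝒟.toCauchyDevelopment.isCompact_causalPast_inter_causalFuture_range hsmooth hemb hU hrange
    hdev hfut (lt_of_lt_of_le hτ₁ hτ₁τ) (hτ₁.trans hz') hpc hpW

/-- **Registered stub `stub_flatExhaustion`** (crux stmt-FinalStateConjecture-17645, line
`registered`; DISPERSAL EXHAUSTION), with the registered header `stub_flatExhaustion :
Sig.stub_flatExhaustion`: the explicit theorem `flatExhaustion`. O'Neill 1983, Ch. 14, pp. 402–403;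
Dafermos–Luk 2017, Conjecture 1. [cite: ONeill1983, Ch. 14 pp. 402–403] -/
theorem stub_flatExhaustion : Sig.stub_flatExhaustion :=
  fun _ _ _ _ _ _ _ _ 𝒟 _ _ _ hsmooth hemb hU hrange hdev hfut _ _ hτ₁ hτ₁τ ↦
    flatExhaustion 𝒟 hsmooth hemb hU hrange hdev hfut hτ₁ hτ₁τ

end Summit.FinalStateConjecture.FinalStateConjecture.Theorems.KerrnessPropagates.KillingSpinorEndgame

end
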